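import Literature.Computability.AlgebraicComplexity.AlperBogartVelascoBoxFour
import Summits.ValiantsHypothesis.ValiantsHypothesis.Theorems.SymPencilBoxFourProfile
import HarnessLib

/-!
# Route `SymPencil` — the BoxFour equality case, I: the row filtration in an arbitrary order
# (`--supports` stmt-ValiantsHypothesis-5674 `SdcSuperquadratic`; rung `sdc(per_4) ≥ 21`)

`AlperBogartVelascoBoxFour.finrank_le_eight_of_subperm_three_vanish`: a linear subspace `W` of
`4 × 4` matrices on which all sixteen `3 × 3` subpermanents vanish has `dim W ≤ 8`.  This file
starts the classification of the EQUALITY CASE `dim W = 8` (finished in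
`SymPencilBoxFourEquality`: two zero rows or two zero columns), which is what the kernel-row
mechanism of `SymPencilSdcPerFourNineteen` needs at sizes `m = 19, 20`.

We rerun the ABV row filtration in an ARBITRARY row order `e 0, e 1, e 2, e 3`
(`e : Equiv.Perm (Fin 4)`): `dim W = Σ_p dim Y_p`, the trilinear forms `T_c` vanish on
`Y_p × Y_q × Y_r`, and the key step (`dim Y_p ≥ 3`, `Y_r ≠ 0` force `dim Y_q ≤ 1`).  With
`dim W = 8` the profile `(dim Y_p)_p` is a permutation of `(4,4,0,0)` or equals `(2,2,2,2)`
(`SymPencilBoxFourProfile.profile_cases`).  In the first case the two positions carrying the `4`'s give a pair of rows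
`p ≠ q` such that `W → (row p, row q)` is injective; in the second, the row-`e 0`-supported part
of `W` has dimension `2` and `row (e 3)` maps `W` onto a `2`-dimensional space
(`filtration_dichotomy`).

The hypothesis is stated in the symmetric form "all `3 × 3` minors-permanents
`per (x.submatrix r c)` with `r, c : Fin 3 → Fin 4` injective vanish", which is invariant under
row/column permutations and transposition. [folklore]
-/

noncomputable section

-- single-conjunct layout: Sub = Summit, duplicated namespace component intended
set_option linter.dupNamespace false

namespace Summit.ValiantsHypothesis.ValiantsHypothesis.Theorems.SymPencilBoxFourFiltration

open Module Finset
open Literature.Computability.AlgebraicComplexity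
open Literature.Computability.AlgebraicComplexity.AlperBogartVelasco
open Summit.ValiantsHypothesis.ValiantsHypothesis.Theorems.SymPencilBoxFourProfile

variable {K : Type*} [Field K]

/-- **The row filtration of the equality case, in the row order `e 0, e 1, e 2, e 3`.**  For a
subspace `W` of `4 × 4` matrices of dimension `8` on which all `3 × 3` subpermanents vanish:
either some pair of rows `p ≠ q` detects `W` (an element of `W` with rows `p, q` zero is zero),
or the elements of `W` supported in row `e 0` form a `2`-dimensional space and row `e 3` maps `W`
onto a `2`-dimensional space. [folklore] -/
theorem filtration_dichotomy (W : Submodule K (Fin 4 × Fin 4 → K))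
    (hW : ∀ x ∈ W, ∀ (r c : Fin 3 → Fin 4), Function.Injective r → Function.Injective c →
      ((Matrix.of fun i j => x (i, j)).submatrix r c).permanent = 0)
    (h8 : finrank K W = 8) (e : Equiv.Perm (Fin 4)) :
    (∃ p q : Fin 4, p ≠ q ∧ ∀ x ∈ W, (∀ j, x (p, j) = 0) → (∀ j, x (q, j) = 0) → x = 0) ∨
    (finrank K ↥(W ⊓ LinearMap.ker (LinearMap.funLeft K K fun j : Fin 4 => (e 3, j)) ⊓
          LinearMap.ker (LinearMap.funLeft K K fun j : Fin 4 => (e 2, j)) ⊓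
          LinearMap.ker (LinearMap.funLeft K K fun j : Fin 4 => (e 1, j))) = 2 ∧
      finrank K ↥(W.map (LinearMap.funLeft K K fun j : Fin 4 => (e 3, j))) = 2) := by
  have hcases : ∀ i : Fin 4, i = 0 ∨ i = 1 ∨ i = 2 ∨ i = 3 := by decide
  -- `succAbove` on `Fin 4`
  have e00 : (0 : Fin 4).succAbove 0 = 1 := by decide
  have e01 : (0 : Fin 4).succAbove 1 = 2 := by decide
  have e02 : (0 : Fin 4).succAbove 2 = 3 := by decide
  have e10 : (1 : Fin 4).succAbove 0 = 0 := by decide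
  have e11 : (1 : Fin 4).succAbove 1 = 2 := by decide
  have e12 : (1 : Fin 4).succAbove 2 = 3 := by decide
  have e20 : (2 : Fin 4).succAbove 0 = 0 := by decide
  have e21 : (2 : Fin 4).succAbove 1 = 1 := by decide
  have e22 : (2 : Fin 4).succAbove 2 = 3 := by decide
  have e30 : (3 : Fin 4).succAbove 0 = 0 := by decide
  have e31 : (3 : Fin 4).succAbove 1 = 1 := by decide
  have e32 : (3 : Fin 4).succAbove 2 = 2 := by decide
  -- distinctness of the rows `e k`
  have hne : ∀ a b : Fin 4, a ≠ b → e a ≠ e b := fun a b h h' => h (e.injective h')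
  have n01 := hne 0 1 (by decide); have n02 := hne 0 2 (by decide)
  have n03 := hne 0 3 (by decide); have n12 := hne 1 2 (by decide)
  have n13 := hne 1 3 (by decide); have n23 := hne 2 3 (by decide)
  -- the trilinear forms: `T c u v w = per` of the rows `u, v, w` on the columns `≠ c`
  let T : Fin 4 → (Fin 4 → K) → (Fin 4 → K) → (Fin 4 → K) → K := fun c u v w =>
    u (c.succAbove 0) * (v (c.succAbove 1) * w (c.succAbove 2) + v (c.succAbove 2) * w (c.succAbove 1)) +
    u (c.succAbove 1) * (v (c.succAbove 0) * w (c.succAbove 2) + v (c.succAbove 2) * w (c.succAbove 0)) +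
    u (c.succAbove 2) * (v (c.succAbove 0) * w (c.succAbove 1) + v (c.succAbove 1) * w (c.succAbove 0))
  have hI2 : ∀ c u v w, T c u w v = 0 → T c u v w = 0 := fun c u v w h => by
    simp only [T] at h ⊢; linear_combination h
  have hI3 : ∀ c u v w, T c v u w = 0 → T c u v w = 0 := fun c u v w h => by
    simp only [T] at h ⊢; linear_combination h
  have hI4 : ∀ c u v w, T c w u v = 0 → T c u v w = 0 := fun c u v w h => by
    simp only [T] at h ⊢; linear_combination h
  have hI5 : ∀ c u v w, T c v w u = 0 → T c u v w = 0 := fun c u v w h => by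
    simp only [T] at h ⊢; linear_combination h
  have hI6 : ∀ c u v w, T c w v u = 0 → T c u v w = 0 := fun c u v w h => by
    simp only [T] at h ⊢; linear_combination h
  -- rows as linear maps
  let ρ : Fin 4 → (Fin 4 × Fin 4 → K) →ₗ[K] (Fin 4 → K) :=
    fun r => LinearMap.funLeft K K fun j => (r, j)
  have hρ : ∀ r x j, ρ r x j = x (r, j) := fun _ _ _ => rfl
  -- the cubics vanishing on `W`, in terms of `T`, for any three distinct rows
  have hF : ∀ y ∈ W, ∀ r₀ r₁ r₂ : Fin 4, r₀ ≠ r₁ → r₀ ≠ r₂ → r₁ ≠ r₂ → ∀ c : Fin 4,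
      T c (ρ r₀ y) (ρ r₁ y) (ρ r₂ y) = 0 := by
    intro y hy r₀ r₁ r₂ h01 h02 h12 c
    have hinj : Function.Injective ![r₀, r₁, r₂] := by
      intro a b hab
      fin_cases a <;> fin_cases b <;> simp_all
    have h := hW y hy ![r₀, r₁, r₂] c.succAbove hinj Fin.succAbove_right_injective
    rw [Matrix.permanent_fin_three_row] at h
    simp only [Matrix.submatrix_apply, Matrix.of_apply, Matrix.cons_val_zero, Matrix.cons_val_one,
      Matrix.cons_val] at h
    simp only [T, hρ]
    linear_combination h
  -- the flag `V₀ ≤ V₁ ≤ V₂ ≤ W` in the order `e`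
  let V₂ : Submodule K (Fin 4 × Fin 4 → K) := W ⊓ LinearMap.ker (ρ (e 3))
  let V₁ : Submodule K (Fin 4 × Fin 4 → K) := V₂ ⊓ LinearMap.ker (ρ (e 2))
  let V₀ : Submodule K (Fin 4 × Fin 4 → K) := V₁ ⊓ LinearMap.ker (ρ (e 1))
  let Y : Fin 4 → Submodule K (Fin 4 → K) :=
    ![V₀.map (ρ (e 0)), V₁.map (ρ (e 1)), V₂.map (ρ (e 2)), W.map (ρ (e 3))]
  have hY0 : Y 0 = V₀.map (ρ (e 0)) := rfl
  have hY1 : Y 1 = V₁.map (ρ (e 1)) := rfl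
  have hY2 : Y 2 = V₂.map (ρ (e 2)) := rfl
  have hY3 : Y 3 = W.map (ρ (e 3)) := rfl
  have memV₂ : ∀ x ∈ V₂, x ∈ W ∧ ∀ j, x (e 3, j) = 0 := fun x hx => by
    simp only [V₂, Submodule.mem_inf, LinearMap.mem_ker] at hx
    exact ⟨hx.1, fun j => congr_fun hx.2 j⟩
  have memV₁ : ∀ x ∈ V₁, x ∈ W ∧ (∀ j, x (e 2, j) = 0) ∧ ∀ j, x (e 3, j) = 0 := fun x hx => by
    simp only [V₁, V₂, Submodule.mem_inf, LinearMap.mem_ker] at hx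
    exact ⟨hx.1.1, fun j => congr_fun hx.2 j, fun j => congr_fun hx.1.2 j⟩
  have memV₀ : ∀ x ∈ V₀, x ∈ W ∧ (∀ j, x (e 1, j) = 0) ∧ (∀ j, x (e 2, j) = 0) ∧
      ∀ j, x (e 3, j) = 0 := fun x hx => by
    simp only [V₀, V₁, V₂, Submodule.mem_inf, LinearMap.mem_ker] at hx
    exact ⟨hx.1.1.1, fun j => congr_fun hx.2 j, fun j => congr_fun hx.1.2 j,
      fun j => congr_fun hx.1.1.2 j⟩
  -- a matrix all of whose rows `e k` vanish is zero
  have hzero : ∀ x : Fin 4 × Fin 4 → K, (∀ j, x (e 0, j) = 0) → (∀ j, x (e 1, j) = 0) →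
      (∀ j, x (e 2, j) = 0) → (∀ j, x (e 3, j) = 0) → x = 0 := by
    intro x h0 h1 h2 h3
    funext ⟨i, j⟩
    obtain ⟨k, rfl⟩ := e.surjective i
    rcases hcases k with rfl | rfl | rfl | rfl
    · exact h0 j
    · exact h1 j
    · exact h2 j
    · exact h3 j
  have hbot : (V₀ ⊓ LinearMap.ker (ρ (e 0)) : Submodule K _) = ⊥ := by
    rw [eq_bot_iff]
    intro x hx
    rw [Submodule.mem_inf, LinearMap.mem_ker] at hx
    obtain ⟨-, h1, h2, h3⟩ := memV₀ x hx.1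
    rw [Submodule.mem_bot]
    exact hzero x (fun j => congr_fun hx.2 j) h1 h2 h3
  -- dimension count along the flag
  have hdimV₀ : finrank K V₀ = finrank K (Y 0) := by
    rw [hY0, finrank_eq_finrank_map_add_finrank_inf_ker V₀ (ρ (e 0)), hbot, finrank_bot, add_zero]
  have hdim : finrank K W = ∑ i, finrank K (Y i) := by
    rw [Fin.sum_univ_four, ← hdimV₀, hY1, hY2, hY3,
      finrank_eq_finrank_map_add_finrank_inf_ker W (ρ (e 3)),
      finrank_eq_finrank_map_add_finrank_inf_ker V₂ (ρ (e 2)),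
      finrank_eq_finrank_map_add_finrank_inf_ker V₁ (ρ (e 1))]
    ring
  -- trilinear vanishing on the flag, sorted triples (polarisation of the cubics)
  have h012 : ∀ u ∈ Y 0, ∀ v ∈ Y 1, ∀ w ∈ Y 2, ∀ c, T c u v w = 0 := by
    intro u hu v hv w hw c
    rw [hY0, Submodule.mem_map] at hu
    rw [hY1, Submodule.mem_map] at hv
    rw [hY2, Submodule.mem_map] at hw
    obtain ⟨x, hx, rfl⟩ := hu
    obtain ⟨x', hx', rfl⟩ := hv
    obtain ⟨x'', hx'', rfl⟩ := hw
    obtain ⟨hxW, hx1, hx2, hx3⟩ := memV₀ x hx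
    obtain ⟨hx'W, hx'2, hx'3⟩ := memV₁ x' hx'
    obtain ⟨hx''W, hx''3⟩ := memV₂ x'' hx''
    have a := hF (x + x' + x'') (W.add_mem (W.add_mem hxW hx'W) hx''W) (e 0) (e 1) (e 2)
      n01 n02 n12 c
    have b := hF (x + x'') (W.add_mem hxW hx''W) (e 0) (e 1) (e 2) n01 n02 n12 c
    have d := hF (x' + x'') (W.add_mem hx'W hx''W) (e 0) (e 1) (e 2) n01 n02 n12 c
    have g := hF x'' hx''W (e 0) (e 1) (e 2) n01 n02 n12 c
    simp only [T, hρ, Pi.add_apply, hx1, hx2, hx'2, zero_add] at a b d g ⊢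
    linear_combination a - b - d + g
  have h013 : ∀ u ∈ Y 0, ∀ v ∈ Y 1, ∀ w ∈ Y 3, ∀ c, T c u v w = 0 := by
    intro u hu v hv w hw c
    rw [hY0, Submodule.mem_map] at hu
    rw [hY1, Submodule.mem_map] at hv
    rw [hY3, Submodule.mem_map] at hw
    obtain ⟨x, hx, rfl⟩ := hu
    obtain ⟨x', hx', rfl⟩ := hv
    obtain ⟨x'', hx''W, rfl⟩ := hw
    obtain ⟨hxW, hx1, hx2, hx3⟩ := memV₀ x hx
    obtain ⟨hx'W, hx'2, hx'3⟩ := memV₁ x' hx'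
    have a := hF (x + x' + x'') (W.add_mem (W.add_mem hxW hx'W) hx''W) (e 0) (e 1) (e 3)
      n01 n03 n13 c
    have b := hF (x + x'') (W.add_mem hxW hx''W) (e 0) (e 1) (e 3) n01 n03 n13 c
    have d := hF (x' + x'') (W.add_mem hx'W hx''W) (e 0) (e 1) (e 3) n01 n03 n13 c
    have g := hF x'' hx''W (e 0) (e 1) (e 3) n01 n03 n13 c
    simp only [T, hρ, Pi.add_apply, hx1, hx3, hx'3, zero_add] at a b d g ⊢
    linear_combination a - b - d + g
  have h023 : ∀ u ∈ Y 0, ∀ v ∈ Y 2, ∀ w ∈ Y 3, ∀ c, T c u v w = 0 := by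
    intro u hu v hv w hw c
    rw [hY0, Submodule.mem_map] at hu
    rw [hY2, Submodule.mem_map] at hv
    rw [hY3, Submodule.mem_map] at hw
    obtain ⟨x, hx, rfl⟩ := hu
    obtain ⟨x', hx', rfl⟩ := hv
    obtain ⟨x'', hx''W, rfl⟩ := hw
    obtain ⟨hxW, hx1, hx2, hx3⟩ := memV₀ x hx
    obtain ⟨hx'W, hx'3⟩ := memV₂ x' hx'
    have a := hF (x + x' + x'') (W.add_mem (W.add_mem hxW hx'W) hx''W) (e 0) (e 2) (e 3)
      n02 n03 n23 c
    have b := hF (x + x'') (W.add_mem hxW hx''W) (e 0) (e 2) (e 3) n02 n03 n23 c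
    have d := hF (x' + x'') (W.add_mem hx'W hx''W) (e 0) (e 2) (e 3) n02 n03 n23 c
    have g := hF x'' hx''W (e 0) (e 2) (e 3) n02 n03 n23 c
    simp only [T, hρ, Pi.add_apply, hx2, hx3, hx'3, zero_add] at a b d g ⊢
    linear_combination a - b - d + g
  have h123 : ∀ u ∈ Y 1, ∀ v ∈ Y 2, ∀ w ∈ Y 3, ∀ c, T c u v w = 0 := by
    intro u hu v hv w hw c
    rw [hY1, Submodule.mem_map] at hu
    rw [hY2, Submodule.mem_map] at hv
    rw [hY3, Submodule.mem_map] at hw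
    obtain ⟨x, hx, rfl⟩ := hu
    obtain ⟨x', hx', rfl⟩ := hv
    obtain ⟨x'', hx''W, rfl⟩ := hw
    obtain ⟨hxW, hx2, hx3⟩ := memV₁ x hx
    obtain ⟨hx'W, hx'3⟩ := memV₂ x' hx'
    have a := hF (x + x' + x'') (W.add_mem (W.add_mem hxW hx'W) hx''W) (e 1) (e 2) (e 3)
      n12 n13 n23 c
    have b := hF (x + x'') (W.add_mem hxW hx''W) (e 1) (e 2) (e 3) n12 n13 n23 c
    have d := hF (x' + x'') (W.add_mem hx'W hx''W) (e 1) (e 2) (e 3) n12 n13 n23 c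
    have g := hF x'' hx''W (e 1) (e 2) (e 3) n12 n13 n23 c
    simp only [T, hρ, Pi.add_apply, hx2, hx3, hx'3, zero_add] at a b d g ⊢
    linear_combination a - b - d + g
  -- all ordered triples of distinct positions
  have hP : ∀ p q r : Fin 4, p ≠ q → p ≠ r → q ≠ r →
      ∀ u ∈ Y p, ∀ v ∈ Y q, ∀ w ∈ Y r, ∀ c, T c u v w = 0 := by
    intro p q r hpq hpr hqr u hu v hv w hw c
    rcases hcases p with rfl | rfl | rfl | rfl <;> rcases hcases q with rfl | rfl | rfl | rfl <;>
      rcases hcases r with rfl | rfl | rfl | rfl <;>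
      (try first | exact absurd rfl hpq | exact absurd rfl hpr | exact absurd rfl hqr)
    · exact h012 u hu v hv w hw c
    · exact h013 u hu v hv w hw c
    · exact hI2 c u v w (h012 u hu w hw v hv c)
    · exact h023 u hu v hv w hw c
    · exact hI2 c u v w (h013 u hu w hw v hv c)
    · exact hI2 c u v w (h023 u hu w hw v hv c)
    · exact hI3 c u v w (h012 v hv u hu w hw c)
    · exact hI3 c u v w (h013 v hv u hu w hw c)
    · exact hI4 c u v w (h012 w hw u hu v hv c)
    · exact h123 u hu v hv w hw c
    · exact hI4 c u v w (h013 w hw u hu v hv c)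
    · exact hI2 c u v w (h123 u hu w hw v hv c)
    · exact hI5 c u v w (h012 v hv w hw u hu c)
    · exact hI3 c u v w (h023 v hv u hu w hw c)
    · exact hI6 c u v w (h012 w hw v hv u hu c)
    · exact hI3 c u v w (h123 v hv u hu w hw c)
    · exact hI4 c u v w (h023 w hw u hu v hv c)
    · exact hI4 c u v w (h123 w hw u hu v hv c)
    · exact hI5 c u v w (h013 v hv w hw u hu c)
    · exact hI5 c u v w (h023 v hv w hw u hu c)
    · exact hI6 c u v w (h013 w hw v hv u hu c)
    · exact hI5 c u v w (h123 v hv w hw u hu c)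
    · exact hI6 c u v w (h023 w hw v hv u hu c)
    · exact hI6 c u v w (h123 w hw v hv u hu c)
  -- KEY STEP: `w_{c₀} ≠ 0`, `dim Y ≥ 3`, `T(Y, Y', w) = 0` force `dim Y' ≤ 1`
  have hPL'' : ∀ (Y₁' Y₂' : Submodule K (Fin 4 → K)) (y'' : Fin 4 → K) (c₀ : Fin 4),
      y'' c₀ ≠ 0 → 3 ≤ finrank K Y₁' → (∀ y ∈ Y₁', ∀ y' ∈ Y₂', ∀ c, T c y y' y'' = 0) →
      finrank K Y₂' ≤ 1 := by
    intro Y₁' Y₂' y'' c₀ hc₀ hY h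
    refine finrank_le_one_of_pairings Y₂' y'' hc₀ fun y' hy' j hj => ?_
    let f : Y₁' →ₗ[K] K × K := ((LinearMap.proj c₀).prod (LinearMap.proj j)).comp Y₁'.subtype
    have hker : LinearMap.ker f ≠ ⊥ := LinearMap.ker_ne_bot_of_finrank_lt (by
      rw [finrank_prod, Module.finrank_self]; omega)
    obtain ⟨yY, hyker, hy0⟩ := Submodule.exists_mem_ne_zero_of_ne_bot hker
    have hfy : f yY = 0 := LinearMap.mem_ker.1 hyker
    have hyY : (yY : Fin 4 → K) ∈ Y₁' := yY.2
    have hyc₀ : (yY : Fin 4 → K) c₀ = 0 := congr_arg Prod.fst hfy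
    have hyj : (yY : Fin 4 → K) j = 0 := congr_arg Prod.snd hfy
    have hyne : (yY : Fin 4 → K) ≠ 0 := fun h0 => hy0 (Subtype.ext h0)
    set y : Fin 4 → K := (yY : Fin 4 → K) with hydef
    have hprod : ∀ i, y i * (y' c₀ * y'' j + y' j * y'' c₀) = 0 := by
      have hpairs : ∀ a b : Fin 4, b ≠ a →
          (a = 0 ∧ b = 1) ∨ (a = 0 ∧ b = 2) ∨ (a = 0 ∧ b = 3) ∨ (a = 1 ∧ b = 0) ∨
          (a = 1 ∧ b = 2) ∨ (a = 1 ∧ b = 3) ∨ (a = 2 ∧ b = 0) ∨ (a = 2 ∧ b = 1) ∨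
          (a = 2 ∧ b = 3) ∨ (a = 3 ∧ b = 0) ∨ (a = 3 ∧ b = 1) ∨ (a = 3 ∧ b = 2) := by decide
      have t0 := h y hyY y' hy' 0
      have t1 := h y hyY y' hy' 1
      have t2 := h y hyY y' hy' 2
      have t3 := h y hyY y' hy' 3
      simp only [T, e00, e01, e02, e10, e11, e12, e20, e21, e22, e30, e31, e32] at t0 t1 t2 t3
      rcases hpairs c₀ j hj with ⟨rfl, rfl⟩ | ⟨rfl, rfl⟩ | ⟨rfl, rfl⟩ | ⟨rfl, rfl⟩ | ⟨rfl, rfl⟩ |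
        ⟨rfl, rfl⟩ | ⟨rfl, rfl⟩ | ⟨rfl, rfl⟩ | ⟨rfl, rfl⟩ | ⟨rfl, rfl⟩ | ⟨rfl, rfl⟩ | ⟨rfl, rfl⟩
      all_goals
        simp only [hyc₀, hyj, zero_mul, zero_add, add_zero] at t0 t1 t2 t3
        intro i
        rcases hcases i with rfl | rfl | rfl | rfl <;>
          first
          | (rw [hyc₀]; ring) | (rw [hyj]; ring)
          | linear_combination t0 | linear_combination t1
          | linear_combination t2 | linear_combination t3
    obtain ⟨i, hi⟩ : ∃ i, y i ≠ 0 := Function.ne_iff.1 hyne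
    exact (mul_eq_zero.1 (hprod i)).resolve_left hi
  -- the count
  have hle : ∀ i, finrank K (Y i) ≤ 4 := fun i =>
    ((Y i).finrank_le).trans (by rw [finrank_fintype_fun_eq_card, Fintype.card_fin])
  have hPLn : ∀ p q r, p ≠ q → p ≠ r → q ≠ r → 1 ≤ finrank K (Y r) → 3 ≤ finrank K (Y p) →
      finrank K (Y q) ≤ 1 := by
    intro p q r hpq hpr hqr hr hp
    have hne' : Y r ≠ ⊥ := fun h => by rw [h, finrank_bot] at hr; exact absurd hr (by decide)
    obtain ⟨w, hw, hw0⟩ := Submodule.exists_mem_ne_zero_of_ne_bot hne'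
    obtain ⟨c₀, hc₀⟩ : ∃ c₀, w c₀ ≠ 0 := Function.ne_iff.1 hw0
    exact hPL'' (Y p) (Y q) w c₀ hc₀ hp fun u hu v hv c => hP p q r hpq hpr hqr u hu v hv w hw c
  have hsum : ∑ i, finrank K (Y i) = 8 := by rw [← hdim, h8]
  -- the two profiles
  rcases profile_cases (fun i => finrank K (Y i)) hle hsum hPLn with hall | ⟨p, q, hpq, hpq0⟩
  · right
    refine ⟨?_, ?_⟩
    · have h := hall 0
      rw [← hdimV₀] at h
      exact h
    · have h := hall 3
      rwa [hY3] at h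
  · left
    refine ⟨e p, e q, hne p q hpq, fun x hx hxp hxq => ?_⟩
    -- rows vanish from the top of the flag down: at position `k` either `k ∈ {p, q}` or `Y k = ⊥`
    have hrow : ∀ k : Fin 4, (k = p ∨ k = q) → ∀ j, x (e k, j) = 0 := by
      rintro k (rfl | rfl) j
      · exact hxp j
      · exact hxq j
    have hYbot : ∀ k : Fin 4, k ≠ p → k ≠ q → Y k = ⊥ := fun k hkp hkq =>
      Submodule.finrank_eq_zero.1 (hpq0 k hkp hkq)
    have step : ∀ (k : Fin 4) (S : Submodule K (Fin 4 × Fin 4 → K)), Y k = S.map (ρ (e k)) →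
        x ∈ S → ∀ j, x (e k, j) = 0 := by
      intro k S hYk hxS j
      by_cases hk : k = p ∨ k = q
      · exact hrow k hk j
      · push Not at hk
        have hb := hYbot k hk.1 hk.2
        rw [hYk] at hb
        have hm : ρ (e k) x ∈ S.map (ρ (e k)) := Submodule.mem_map_of_mem hxS
        rw [hb, Submodule.mem_bot] at hm
        exact congr_fun hm j
    have h3 := step 3 W hY3 hx
    have hx2 : x ∈ V₂ := by
      simp only [V₂, Submodule.mem_inf, LinearMap.mem_ker]
      exact ⟨hx, funext h3⟩
    have h2 := step 2 V₂ hY2 hx2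
    have hx1 : x ∈ V₁ := by
      simp only [V₁, Submodule.mem_inf, LinearMap.mem_ker]
      exact ⟨hx2, funext h2⟩
    have h1 := step 1 V₁ hY1 hx1
    have hx0 : x ∈ V₀ := by
      simp only [V₀, Submodule.mem_inf, LinearMap.mem_ker]
      exact ⟨hx1, funext h1⟩
    have h0 := step 0 V₀ hY0 hx0
    exact hzero x h0 h1 h2 h3

end Summit.ValiantsHypothesis.ValiantsHypothesis.Theorems.SymPencilBoxFourFiltration

end
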